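import Mathlib
import HarnessLib
import Literature.MathematicalPhysics.QuantumLattice.HubbardUVSymbolCTDifferences
import Summits.HubbardSuperconductivity.HubbardSuperconductivity.Theorems.KLProgrammeC4aPPKernelModelWindowSum
import Summits.HubbardSuperconductivity.HubbardSuperconductivity.Theorems.KLProgrammeC4aPPKernelShiftNumerator

/-!
# Route `KLProgramme` — crux C4a, S3 brick (B4) «(B4)-UMK1», «(B3)-K MODEL WINDOW» part 5: NONZERO TRANSFER FREQUENCY — the all-frequency pair kernel `K_Ω`
# (`Ω = 2mπ/β`), its ratio form `K_Ω = N_Ω/(e+u−iΩ)`, `K_0 = P`, and the second-order vertex's `S_pp` at EVERY slice frequency as a windowed pair sum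

Cell `gate-hubbard-kl`, seat hubbard-kl-k3c3-p1 (g18; row «δμ-flow with klAngularMean constant piece»).  Parts 1–4 (`…ModelWindow`, `…Sum`, `…Bubble`, `…Jets`) identify the
model's pp bubble with `P = ppTrueKernel` at ZERO transfer (the Cooper channel's singular slice frequency).  The tadpole leg's other slice frequencies `p₀` give the
transfer label `t = n_κ + n_{p₀}` (`S_pp = Σ_{p,p′}[n_p + n_{p′} = t ∧ p⃗ + p⃗′ = S⃗]Ψ_nΨ_n′`, `…C4aSecondOrderVertexModel`), i.e. the bosonic transfer `Ω = ppBose β (t+1)`;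
g15's `…C4aPPKernelShiftNumerator` typed the NUMERATOR `N_Ω` (`ℤ`-series, `m ≠ 0`).  Here:
* §10 def `ppTransferKernel β Λ m e u = (1/β)Σ_{n∈ℤ} Ψ̂(ωₙ,e)Ψ̂(Ω−ωₙ,u)` (`K_Ω`, ALL frequencies) and def `ppTransferWindowSum β Λ c M t e u` (the MODEL's windowed pair sum
  `Σᵢ [−M ≤ t−nᵢ < M] Ψ_c(e,ωᵢ)Ψ_c(u,Ω−ωᵢ)`); `norm_uvSymbolFnXi_mul_le`, **`summable_ppTransferKernel`** (absolute, every `m`), **`ppTransferKernel_eq_numerator_div`**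
  (`m ≠ 0 ⟹ K_Ω = N_Ω/(e+u−iΩ)`), **`ppTransferKernel_zero_eq_ppTrueKernel`** (`K_0 = P`), the window combinatorics `sum_ite_matsubaraInt_eq` (an integer label has ONE index in
  `[−M,M)`, none outside), `matsubaraFreq_eq_ppBose_sub`, `sum_sum_ite_pp_transfer_eq`, and **`secondOrder_ppBubble_transfer_eq`**:
  `S_pp(t) = Σ_{p⃗} ppTransferWindowSum β Λ (βL²) M t (e_K p⃗) (e_K(S⃗−p⃗))` — EXACT, every `t`.
Part 6 (`…ModelWindowTransferTail`) bounds the window tail `‖K_Ω − (1/β)W₁‖ ≤ 4/ω_M` for `2|Ω| ≤ ω_M`.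
Pure real/complex analysis and finite combinatorics on Literature objects; nothing asserts (C), any engine row, K3, the window or superconductivity.
References: BGM 2006 §2.1 (2.3)–(2.4), §2.3 [cite: BenfattoGiulianiMastropietro2006]; Salmhofer 1999 §2.4, §4.2.4 (4.63), §4.2.5 (4.70) [cite: Salmhofer1999].
-/

noncomputable section

namespace Summit.HubbardSuperconductivity.HubbardSuperconductivity.Theorems.C4a

set_option linter.dupNamespace false -- summit = problem name (single-conjunct summit), D-0017

open Real Filter Set Finset Complex
open scoped Topology
open Literature.MathematicalPhysics.QuantumLattice Literature.Analysis.SpecialFunctions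

/-! ## §10 NONZERO TRANSFER: the pair kernel `K_Ω` (all frequencies), its ratio form, the model's WINDOWED pair sum, and the vertex's `S_pp` at every slice frequency -/

section Transfer

open Literature.Probability.LatticeModels

/-- **The pp pair kernel at transfer frequency `Ω = 2mπ/β`, all frequencies**: `K_Ω(e,u) = (1/β)Σ_{n∈ℤ} Ψ̂(ωₙ,e)·Ψ̂(Ω−ωₙ,u)` (`Ψ̂ = uvSymbolFnXi 1 Λ`). -/
def ppTransferKernel (β Λ : ℝ) (m : ℤ) (e u : ℝ) : ℂ :=
  ((1 / β : ℝ) : ℂ) * ∑' n : ℤ, uvSymbolFnXi 1 Λ (ppFreqZ β n) e * uvSymbolFnXi 1 Λ (ppBose β m - ppFreqZ β n) u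

/-- **The model's WINDOWED pair sum at integer transfer label `t`** (`n + n′ = t`, both labels in `[−M, M)`; transfer frequency `Ω = ω_n + ω_{t−n} = ppBose β (t+1)`):
`Σ_{i : MatsubaraIdx M} [−M ≤ t − nᵢ < M]·Ψ_c(e, ωᵢ)·Ψ_c(u, Ω − ωᵢ)` (`Ψ_c = uvSymbolFn c Λ`, `c = βL²` for the lattice symbol). -/
def ppTransferWindowSum (β Λ c : ℝ) (M : ℕ) (t : ℤ) (e u : ℝ) : ℂ :=
  ∑ i : MatsubaraIdx M, if -(M : ℤ) ≤ t - matsubaraInt M i ∧ t - matsubaraInt M i < M then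
    uvSymbolFn c Λ e (matsubaraFreq β M i) * uvSymbolFn c Λ u (ppBose β (t + 1) - matsubaraFreq β M i) else 0

/-- `‖Ψ̂(ω,x)‖·‖Ψ̂(ω′,y)‖ ≤ 4·(1/(ω²+Λ²) + 1/(ω′²+Λ²))`. [cite: BenfattoGiulianiMastropietro2006, §2.1 (2.3)] -/
theorem norm_uvSymbolFnXi_mul_le {Λ : ℝ} (hΛ : 0 < Λ) (ω ω' x y : ℝ) :
    ‖uvSymbolFnXi 1 Λ ω x * uvSymbolFnXi 1 Λ ω' y‖ ≤ 4 * (1 / (ω ^ 2 + Λ ^ 2) + 1 / (ω' ^ 2 + Λ ^ 2)) := by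
  rw [norm_mul]
  have h1 : ‖uvSymbolFnXi 1 Λ ω x‖ ≤ 1 / max |ω| (Λ / 2) := by rw [← uvSymbolFn_eq_uvSymbolFnXi]; exact norm_uvSymbolFn_le hΛ zero_le_one _
  have h2 : ‖uvSymbolFnXi 1 Λ ω' y‖ ≤ 1 / max |ω'| (Λ / 2) := by rw [← uvSymbolFn_eq_uvSymbolFnXi]; exact norm_uvSymbolFn_le hΛ zero_le_one _
  have ha := inv_max_sq_le hΛ ω
  have hb := inv_max_sq_le hΛ ω'
  set a := 1 / max |ω| (Λ / 2) with hadef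
  set b := 1 / max |ω'| (Λ / 2) with hbdef
  have ha0 : 0 ≤ a := by positivity
  have hb0 : 0 ≤ b := by positivity
  have h4 : a ^ 2 ≤ 8 * (1 / (ω ^ 2 + Λ ^ 2)) := by rw [hadef, one_div_pow, ← div_eq_mul_one_div]; exact ha
  have h5 : b ^ 2 ≤ 8 * (1 / (ω' ^ 2 + Λ ^ 2)) := by rw [hbdef, one_div_pow, ← div_eq_mul_one_div]; exact hb
  calc ‖uvSymbolFnXi 1 Λ ω x‖ * ‖uvSymbolFnXi 1 Λ ω' y‖ ≤ a * b := mul_le_mul h1 h2 (norm_nonneg _) ha0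
    _ ≤ 4 * (1 / (ω ^ 2 + Λ ^ 2) + 1 / (ω' ^ 2 + Λ ^ 2)) := by nlinarith [sq_nonneg (a - b), h4, h5]

/-- **`K_Ω`'s series is absolutely summable** (every `m`, no pairing, no denominator condition). [cite: BenfattoGiulianiMastropietro2006, §2.1 (2.3)] -/
theorem summable_ppTransferKernel {β Λ : ℝ} (hβ : 0 < β) (hΛ : 0 < Λ) (m : ℤ) (e u : ℝ) :
    Summable fun n : ℤ => uvSymbolFnXi 1 Λ (ppFreqZ β n) e * uvSymbolFnXi 1 Λ (ppBose β m - ppFreqZ β n) u :=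
  Summable.of_norm_bounded ((((summable_one_div_ppFreqZ_sq_add_sq hβ Λ).add (summable_one_div_shift_sq_add_sq hβ m Λ))).mul_left 4)
    fun n => norm_uvSymbolFnXi_mul_le hΛ (ppFreqZ β n) (ppBose β m - ppFreqZ β n) e u

/-- **RATIO FORM at nonzero transfer**: `m ≠ 0 ⟹ K_Ω(e,u) = N_Ω(e,u)/(e + u − iΩ)` with `N_Ω = ppShiftNumerator β Λ m` (`…C4aPPKernelShiftNumerator`), for ALL levels.
[cite: BenfattoGiulianiMastropietro2006, §2.1 (2.3)] -/
theorem ppTransferKernel_eq_numerator_div {β Λ : ℝ} (hβ : 0 < β) (hΛ : 0 < Λ) {m : ℤ} (hm : m ≠ 0) (e u : ℝ) :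
    ppTransferKernel β Λ m e u = ppShiftNumerator β Λ m e u / ((e : ℂ) + u - I * (ppBose β m : ℝ)) := by
  have hs := transferDen_ne_zero hβ hm e u
  unfold ppTransferKernel ppShiftNumerator
  rw [mul_div_assoc, ← tsum_div_const]
  congr 1
  refine tsum_congr fun n => ?_
  rw [ppShiftSummand_eq_prod hΛ m e u hs n, mul_div_cancel_right₀ _ hs]

/-- **At zero transfer `K_0` is the window kernel's all-frequency limit `P`**: `K_{Ω=0}(e,u) = P(e,u)` (`m = 0`: the `ℤ`-series splits into `n ≥ 0` and
`n = −1−k`, `ω_{−1−k} = −ω_k`, and each pair is `2·ppKernelSummand`). [cite: BenfattoGiulianiMastropietro2006, §2.1 (2.3)-(2.4)] -/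
theorem ppTransferKernel_zero_eq_ppTrueKernel {β Λ : ℝ} (hβ : 0 < β) (hΛ : 0 < Λ) (e u : ℝ) :
    ppTransferKernel β Λ 0 e u = ((ppTrueKernel β Λ e u : ℝ) : ℂ) := by
  have hsum := summable_ppTransferKernel hβ hΛ 0 e u
  set a : ℤ → ℂ := fun n => uvSymbolFnXi 1 Λ (ppFreqZ β n) e * uvSymbolFnXi 1 Λ (ppBose β 0 - ppFreqZ β n) u with ha
  have hz : ∀ n : ℤ, ppBose β 0 - ppFreqZ β n = -ppFreqZ β n := fun n => by unfold ppBose; push_cast; ring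
  have hnat : ∀ k : ℕ, ppFreqZ β (k : ℤ) = ppFreq β k := fun k => by unfold ppFreqZ ppFreq; push_cast; ring
  have hneg : ∀ k : ℕ, ppFreqZ β (-((k : ℤ) + 1)) = -ppFreq β k := fun k => by unfold ppFreqZ ppFreq; push_cast; ring
  have hpair : ∀ k : ℕ, a (k : ℤ) + a (-((k : ℤ) + 1)) = ((2 * ppKernelSummand β Λ e u k : ℝ) : ℂ) := by
    intro k
    simp only [ha, hz, hnat, hneg, neg_neg]
    exact uvSymbolFnXi_pair_add (Λ := Λ) (ppFreq_pos hβ k).ne' e u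
  have h1 : Summable fun k : ℕ => a (k : ℤ) := hsum.comp_injective Nat.cast_injective
  have h2 : Summable fun k : ℕ => a (-((k : ℤ) + 1)) :=
    hsum.comp_injective fun x y h => by simpa using h
  -- split the `ℤ`-series
  have hsplit := tsum_of_nat_of_neg_add_one h1 h2
  unfold ppTransferKernel
  rw [show (∑' n : ℤ, uvSymbolFnXi 1 Λ (ppFreqZ β n) e * uvSymbolFnXi 1 Λ (ppBose β 0 - ppFreqZ β n) u) = ∑' n : ℤ, a n from rfl, hsplit,
    ← h1.tsum_add h2, tsum_congr hpair, ppTrueKernel_eq_tsum_ppKernelSummand]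
  rw [Complex.ofReal_mul, Complex.ofReal_tsum]
  push_cast
  rw [← tsum_mul_left, ← tsum_mul_left]
  refine tsum_congr fun k => ?_
  have hβ0 : (β : ℂ) ≠ 0 := by exact_mod_cast hβ.ne'
  field_simp

/-! ### The windowed pair sum is the vertex's constrained double sum -/

/-- The fiber of an integer label in the window has ONE element inside `[−M, M)` and NONE outside. [folklore] -/
theorem sum_ite_matsubaraInt_eq {M : ℕ} {E : Type*} [AddCommMonoid E] (n' : ℤ) (c : E) :
    ∑ i : MatsubaraIdx M, (if matsubaraInt M i = n' then c else 0) = if -(M : ℤ) ≤ n' ∧ n' < M then c else 0 := by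
  classical
  by_cases h : -(M : ℤ) ≤ n' ∧ n' < M
  · rw [if_pos h]
    have hlt : (n' + M).toNat < 2 * M := by omega
    set i₀ : MatsubaraIdx M := ⟨(n' + M).toNat, hlt⟩ with hi₀
    have hi₀n : matsubaraInt M i₀ = n' := by simp only [matsubaraInt, hi₀]; omega
    rw [Finset.sum_eq_single i₀]
    · rw [if_pos hi₀n]
    · intro i _ hne
      rw [if_neg]
      intro hi
      apply hne
      apply Fin.ext
      have : matsubaraInt M i = matsubaraInt M i₀ := by rw [hi, hi₀n]
      unfold matsubaraInt at this
      omega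
    · intro hi; exact absurd (Finset.mem_univ _) hi
  · rw [if_neg h]
    refine Finset.sum_eq_zero fun i _ => ?_
    rw [if_neg]
    intro hi
    apply h
    rw [← hi]
    unfold matsubaraInt
    have := i.isLt
    omega

/-- The frequency of the label `n′` (when it is in the window): `ω_{n′} = Ω − ω_n` with `Ω = ppBose β (t+1)`, `n′ = t − n`. [folklore] -/
theorem matsubaraFreq_eq_ppBose_sub {β : ℝ} {M : ℕ} (t : ℤ) (i i' : MatsubaraIdx M) (h : matsubaraInt M i + matsubaraInt M i' = t) :
    matsubaraFreq β M i' = ppBose β (t + 1) - matsubaraFreq β M i := by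
  unfold matsubaraFreq ppBose
  have h' : (matsubaraInt M i' : ℝ) = (t : ℝ) - (matsubaraInt M i : ℝ) := by
    have := congrArg (fun z : ℤ => (z : ℝ)) h; push_cast at this; linarith
  rw [h']
  push_cast
  ring

variable {L : ℕ}

/-- **Constrained pair sum at transfer label `t`**: summing `f(p)·g(freq p′, p⃗′)` over partners `p′` with `n_p + n_{p′} = t ∧ p⃗ + p⃗′ = S⃗` picks, for each line
`p`, the window indicator of `t − n_p` times `g(Ω − ω_p, S⃗ − p⃗)`. [folklore] -/
theorem sum_sum_ite_pp_transfer_eq {M : ℕ} [NeZero L] (β : ℝ) (t : ℤ) (f : FreqMomentum L M → ℂ) (g : ℝ → TorusSite 2 L → ℂ) (S : TorusSite 2 L) :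
    ∑ p : FreqMomentum L M, ∑ p' : FreqMomentum L M,
        (if matsubaraInt M p.1 + matsubaraInt M p'.1 = t ∧ p.2 + p'.2 = S then f p * g (matsubaraFreq β M p'.1) p'.2 else 0) =
      ∑ p : FreqMomentum L M, if -(M : ℤ) ≤ t - matsubaraInt M p.1 ∧ t - matsubaraInt M p.1 < M then
        f p * g (ppBose β (t + 1) - matsubaraFreq β M p.1) (S - p.2) else 0 := by
  classical
  refine Finset.sum_congr rfl fun p _ => ?_
  -- collapse the momentum coordinate of the partner
  rw [Fintype.sum_prod_type]
  have hinner : ∀ i' : MatsubaraIdx M, ∑ v' : TorusSite 2 L,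
      (if matsubaraInt M p.1 + matsubaraInt M i' = t ∧ p.2 + v' = S then f p * g (matsubaraFreq β M i') v' else 0) =
        if matsubaraInt M i' = t - matsubaraInt M p.1 then f p * g (ppBose β (t + 1) - matsubaraFreq β M p.1) (S - p.2) else 0 := by
    intro i'
    by_cases hi : matsubaraInt M i' = t - matsubaraInt M p.1
    · rw [if_pos hi]
      have hsum : matsubaraInt M p.1 + matsubaraInt M i' = t := by omega
      have hcond : ∀ v' : TorusSite 2 L, (matsubaraInt M p.1 + matsubaraInt M i' = t ∧ p.2 + v' = S) ↔ S - p.2 = v' := by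
        intro v'
        constructor
        · rintro ⟨_, h2⟩; rw [← h2]; abel
        · intro h; refine ⟨hsum, ?_⟩; rw [← h]; abel
      simp_rw [hcond, Finset.sum_ite_eq, Finset.mem_univ, if_true, matsubaraFreq_eq_ppBose_sub t p.1 i' hsum]
    · rw [if_neg hi]
      refine Finset.sum_eq_zero fun v' _ => ?_
      rw [if_neg]
      rintro ⟨h1, _⟩
      exact hi (by omega)
  simp_rw [hinner]
  exact sum_ite_matsubaraInt_eq (t - matsubaraInt M p.1) _

/-- **THE pp BUBBLE OF THE SECOND-ORDER TADPOLE VERTEX AT EVERY SLICE FREQUENCY**: with transfer label `t = n_κ + n_{p₀}`, the constrained double sum of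
`Ψ_n(p)Ψ_n(p′)` is the lattice-momentum sum of the WINDOWED pair sum `ppTransferWindowSum β Λ (βL²) M t (e_K p⃗) (e_K(S⃗ − p⃗))` (`S⃗ = k⃗ + q⃗`; transfer frequency
`Ω = ppBose β (t+1)`; at `t = −1` this is part 3's `secondOrder_ppBubble_zeroTransfer_eq`). [cite: BenfattoGiulianiMastropietro2006, §2.1 (2.3)-(2.4)] -/
theorem secondOrder_ppBubble_transfer_eq {M : ℕ} [NeZero L] {β : ℝ} (hβ : 0 < β) (μ : ℝ) (K : TrigPolyC4v) (Λ : ℝ) (t : ℤ) (S : TorusSite 2 L) :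
    ∑ p : FreqMomentum L M, ∑ p' : FreqMomentum L M,
        (if matsubaraInt M p.1 + matsubaraInt M p'.1 = t ∧ p.2 + p'.2 = S then
          uvSymbolCT L M β μ K Λ (p, 0) * uvSymbolCT L M β μ K Λ (p', 0) else 0) =
      ∑ pv : TorusSite 2 L, ppTransferWindowSum β Λ (β * (L : ℝ) ^ 2) M t (nambuXiCT L μ K pv) (nambuXiCT L μ K (S - pv)) := by
  have hΨ : ∀ p' : FreqMomentum L M, uvSymbolCT L M β μ K Λ (p', 0) = uvSymbolFn (β * (L : ℝ) ^ 2) Λ (nambuXiCT L μ K p'.2) (matsubaraFreq β M p'.1) :=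
    fun p' => uvSymbolCT_eq_uvSymbolFn hβ μ K Λ p'.1 p'.2 0
  simp_rw [hΨ]
  rw [sum_sum_ite_pp_transfer_eq β t (fun p => uvSymbolFn (β * (L : ℝ) ^ 2) Λ (nambuXiCT L μ K p.2) (matsubaraFreq β M p.1))
    (fun ω v => uvSymbolFn (β * (L : ℝ) ^ 2) Λ (nambuXiCT L μ K v) ω) S, Fintype.sum_prod_type, Finset.sum_comm]
  refine Finset.sum_congr rfl fun pv _ => ?_
  unfold ppTransferWindowSum
  rfl

end Transfer

end Summit.HubbardSuperconductivity.HubbardSuperconductivity.Theorems.C4a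

end
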